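import Literature.MathematicalPhysics.QuantumFieldTheory.Balaban1983to89.B9Eq3134MatrixConcrete
import Literature.MathematicalPhysics.QuantumFieldTheory.Balaban1983to89.B9SectDL2Decay

/-!
# `Balaban1983to89.B9Delta2PiMajorant` — T. Bałaban, *Propagators for lattice gauge theories in a background field*, Commun. Math. Phys.
**99** (1985) 389–434 [Balaban1985BackgroundPropagators], Sect. D, (3.135) p. 422 and (3.138) p. 423: **`Δ⁽²⁾_π` IS SMALL IN THE PROPER
SENSE OF THE RANDOM-WALK EXPANSION** — the block majorant of `Δ⁽²⁾_π = Δ⁽²⁾ − DRG′D*Δ⁽²⁾ − Δ⁽²⁾DG′RD* + DRG′D*Δ⁽²⁾DG′RD*` ((3.135)) from the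
majorant of `Δ⁽²⁾` (FILE 74 §7, `B9Eq3134MatrixConcrete.hasMaj_delta2_calC_exp`, for [5]'s CONCRETE `C_j⁽²⁾` realised as the matrix `𝒞 = calC`)
and the printed majorants of `DG′RD*`, `DRG′D*` (letters), composed by [4] (2.52)–(2.55) (r16's `B11SectG.hasMaj_comp_exp`); and the (3.138)
bookkeeping «G₁ = Σ_n G₀((Δ′_π + Δ⁽²⁾_π)G₀)ⁿ … convergent for α₀ restricted by a small, absolute constant» with its `Δ⁽²⁾_π` summand now CONCRETE
(`B9SectDL2Decay.rightEntry_majorant` fed with `T′ = Δ′_π + Δ⁽²⁾_π`, `Δ′_π` a letter) — FILE 76 of the Sect. B–D programme of cell `lit-balaban`,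
seat r06 (B9 fold owner)

statement-level skeleton of published theorems with citation tags; proofs where landed; nothing here is a claim about the Yang–Mills mass gap

CITATION HEADER (lean-in-tree rule).  B9 = [Balaban1985BackgroundPropagators] (held `paper:balaban1985-cmp99-background-propagators`, journal page =
PDF page + 388; renders `…-p034-x2.png`/`…-p035-x2.png` re-read as images by this seat 2026-08-24).  p. 422 [PDF 34]: «Let us define ⟨A,Δ⁽²⁾A⟩ =
2⟨HC⁽²⁾(A),J⟩. (3.134) A meaning of Δ⁽²⁾_π is obvious, it defines the second quadratic form in (3.128), Δ⁽²⁾_π = Δ⁽²⁾ − DRG′D\*Δ⁽²⁾ − Δ⁽²⁾DG′RD\* +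
DRG′D\*Δ⁽²⁾DG′RD\*. (3.135)»; p. 423 [PDF 35]: «hence |(Δ⁽²⁾A)(b)| ≦ O(1)Mα₀(Lʲη)⁻²|A|, b∈Δ(y), y∈Λ_j, (3.137) and the supremum |A| is taken over
several j-blocks surrounding Δ(y). This bound implies that the operators Δ⁽²⁾, Δ⁽²⁾_π are small in a proper sense, if α₀ is sufficiently small.
Similarly as in (3.130) we get G₁ = G₀(I − (Δ′_π + Δ⁽²⁾_π)G₀)⁻¹ = Σ_{n=0}^∞ G₀((Δ′_π + Δ⁽²⁾_π)G₀)ⁿ. (3.138) … the series (3.138) is convergent for α₀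
restricted by a small, absolute constant. The convergence is in all norms appearing in the formulation of Theorem 3.3. This implies that the
theorem is valid for G₁.»  [4] = [Balaban1984PropagatorsII] (2.51)–(2.55) p. 232 (majorants, their products and sums), Lemma 2.1 (2.61) p. 234
(row sum).  Rows **B9.Eq3.134** / **B9.Eq3.138** (cells; heads are the lead's word).

WHAT IS PROVED (kernel, 0 sorry, 0 named facts; theorems only + one `rfl` lemma).
* §1 `hasMaj_dress` (GENERIC over a block-normed space `b` on an `ℝ`-module, [4] (2.52)–(2.55) bookkeeping): if `Δ2`, `A`, `B` have majorants
  `θe^{−ρ₀d}`, `p′e^{−ρ₀d}`, `pe^{−ρ₀d}`, then `Δ2 − A∘Δ2 − Δ2∘B + A∘Δ2∘B` has the majorant `θ(1 + κp′c + κpc + κ²pp′c²)·e^{−ρd}` for `ρ + 2σ ≤ ρ₀`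
  (`σ` the rate spent on the row sum (2.61), constant `c`; `κ` the cut constant of `b`).
* §2 `piOp_expand` — (3.135) AS PRINTED from p10's definition `Δ⁽²⁾_π := TᵀΔ⁽²⁾T` (`B9SectDFP.piOp`, `T = tOp = 1 − DG′RD*`): `TᵀKT = K − (1−Tᵀ)K −
  K(1−T) + (1−Tᵀ)K(1−T)` (`1 − T` = «DG′RD\*», `1 − Tᵀ` = «DRG′D\*» for symmetric `Δ`, p10's `tOp_transpose`); `mulVecLin_piOp` (operator form);
  **`hasMaj_piOp`** (any matrix `K` with majorant `θe^{−ρ₀d}` and majorants for `1 − T`, `1 − Tᵀ` ⟹ majorant of `piOp K`).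
* §3 **`hasMaj_delta2pi_calC`** — FOR THE CONCRETE `Δ⁽²⁾ = delta2 calC` of FILE 74 (regime of `B7Eq136SecondOrder` verbatim; budget, box range `R`,
  block map `blk` as in FILE 74 §7): p10's `Δ⁽²⁾_π = B9Delta2Def134.delta2pi calC Δ Q a D` has the majorant `θ_π·e^{−ρd}` between the sharp-block sup
  sizes, `θ_π = θ_Δe^{(ρ+2σ)R}(1 + p′c + pc + pp′c²)`, `θ_Δ = [2dC₃‖τ‖(Σ_i‖e_i‖)M_e c₀·#lv]·(Mα₀)` — «Δ⁽²⁾_π small in a proper sense», `O(1)·Mα₀`.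
* §4 **`series3138_rightEntry`** — (3.138) FOR THE RIGHT ENTRIES `G₁F` with the `Δ⁽²⁾_π` SUMMAND CONCRETE: `B9SectDL2Decay.rightEntry_majorant` with
  `T′ = Δ′_π + Δ⁽²⁾_π`, `Δ′_π` a letter with majorant `θ₁e^{−δ₁d}` (rows 3.120ff), `G₀`, `F`, the a-priori bound and `q < 1` letters as there.

HONEST SCOPE / NOT CLAIMED.  (i) `D`, `G′`, `R`, `Δ`, `Q`, `a` are p10's matrix letters of `B9SectDFP` (rows 3.114–3.122 by reference); the majorants
of `DG′RD*` and `DRG′D*` («the same properties as for G′», Thm 3.3-type bounds, rows 3.42ff) are HYPOTHESES `hP`, `hPt` of printed shape — not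
proved here.  (ii) `Δ′_π` of (3.120) and `G₀ = (Δ_π + DRD* + Q*aQ)⁻¹`'s Thm 3.3 majorant are letters (`hT1`, `hG0`, `hS`), exactly as in
`B9SectDL2Decay`; only the `Δ⁽²⁾_π` summand of `T′` is discharged on [5]'s concrete `C_j⁽²⁾`.  (iii) Geometry `g`, block map `blk`, box range `R`,
row-sum letters (`Triangle254`, `RowSum σ c`) as in FILE 74 §7 / `B11SectG` (flat per-level carrier; `𝔅` not modelled — located in FILE 74 (iii),
(vi)).  (iv) Sup-block sizes only (`BlockNorm.ofBlocks`); the `L²`/Hölder entries of «all norms appearing in the formulation of Theorem 3.3» are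
`B9SectDL2Decay`/`B9SectDSup` letters untouched.  (v) Constants explicit, unoptimised.  NOT summit progress.

RELATED IN THE TREE, NOT DUPLICATED (searched 2026-08-24: stems `*Delta2*`, `*3135*`, `*3138*`, `*piOp*` in `Balaban1983to89/`): p10 `B9Delta2Def134`
(`delta2pi`, `eq_3135` — USED), `B9SectDFP` (`piOp`, `tOp` — USED), r16 `B11SectG` (`HasMaj` algebra — USED), `B9SectDL2Decay` (`rightEntry_majorant` —
USED), r06 `B9Eq3130Neumann` ((3.138) with `Δ′_π + Δ⁽²⁾_π` as ONE letter), FILE 74 `B9Eq3134MatrixConcrete` v1.1 §7 (the `Δ⁽²⁾` majorant — USED).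
Unit `lit-balaban-r06`, HOME `run/shared/lean/pub/lit-balaban/`.
-/

noncomputable section

open scoped BigOperators Matrix

namespace Literature.MathematicalPhysics.QuantumFieldTheory.Balaban1983to89.B9Delta2PiMajorant

open Literature.MathematicalPhysics.QuantumFieldTheory.Balaban1983to89
open B11SectG

/-! ## §1 The dressing algebra over block majorants ([4] (2.52)–(2.55)) -/

section Dress

variable {g : B6.Geometry} {F : Type} [AddCommGroup F] [Module ℝ F]

/-- **dressing a small operator by two bounded ones keeps it small**: `Δ2`, `A`, `B` with majorants `θe^{−ρ₀d}`, `p′e^{−ρ₀d}`, `pe^{−ρ₀d}` ⟹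
`Δ2 − A∘Δ2 − Δ2∘B + A∘(Δ2∘B)` has majorant `(θ + κp′θc + κθpc + κp′(κθpc)c)·e^{−ρd}` whenever `ρ ≥ 0`, `σ ≥ 0`, `ρ + 2σ ≤ ρ₀` — three uses of
(2.52)/(2.55) with the row sum (2.61) at rate `σ` (`B11SectG.hasMaj_comp_exp`) and «a summation preserves it also».
[cite: Balaban1984PropagatorsII, (2.52)–(2.55) p.232, (2.61) p.234] [cite: Balaban1985BackgroundPropagators, (3.135) p.422] -/
theorem hasMaj_dress {b : BlockNorm g F} {Δ2 A B : Module.End ℝ F} {θ p p' ρ₀ ρ σ c : ℝ}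
    (htri : B6RandomWalk.Triangle254 g) (hd : ∀ y y' : g.Site, 0 ≤ g.dist y y') (hrow : RowSum g σ c) (hc : 0 ≤ c)
    (hθ : 0 ≤ θ) (hp : 0 ≤ p) (hp' : 0 ≤ p') (hρ : 0 ≤ ρ) (hσ : 0 ≤ σ) (hρσ : ρ + 2 * σ ≤ ρ₀)
    (hΔ : HasMaj b b Δ2 (fun y y' => θ * Real.exp (-(ρ₀ * g.dist y y'))))
    (hA : HasMaj b b A (fun y y' => p' * Real.exp (-(ρ₀ * g.dist y y'))))
    (hB : HasMaj b b B (fun y y' => p * Real.exp (-(ρ₀ * g.dist y y')))) :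
    HasMaj b b (Δ2 - A ∘ₗ Δ2 - Δ2 ∘ₗ B + A ∘ₗ (Δ2 ∘ₗ B))
      (fun y y' => (θ + b.κ * p' * θ * c + b.κ * θ * p * c + b.κ * p' * (b.κ * θ * p * c) * c) *
        Real.exp (-(ρ * g.dist y y'))) := by
  have hκ := b.κ_nonneg
  have h1 : HasMaj b b Δ2 (fun y y' => θ * Real.exp (-(ρ * g.dist y y'))) := hΔ.of_rate_le hd hθ (by linarith)
  have h2 : HasMaj b b (A ∘ₗ Δ2) (fun y y' => b.κ * p' * θ * c * Real.exp (-(ρ * g.dist y y'))) :=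
    hasMaj_comp_exp htri hd hrow hp' hθ hρ (by linarith) (by linarith) hA hΔ
  have h3 : HasMaj b b (Δ2 ∘ₗ B) (fun y y' => b.κ * θ * p * c * Real.exp (-(ρ * g.dist y y'))) :=
    hasMaj_comp_exp htri hd hrow hθ hp hρ (by linarith) (by linarith) hΔ hB
  have h3' : HasMaj b b (Δ2 ∘ₗ B) (fun y y' => b.κ * θ * p * c * Real.exp (-((ρ + σ) * g.dist y y'))) :=
    hasMaj_comp_exp htri hd hrow hθ hp (by linarith) (by linarith) (by linarith) hΔ hB
  have h4 : HasMaj b b (A ∘ₗ (Δ2 ∘ₗ B))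
      (fun y y' => b.κ * p' * (b.κ * θ * p * c) * c * Real.exp (-(ρ * g.dist y y'))) :=
    hasMaj_comp_exp htri hd hrow hp' (by positivity) hρ (by linarith) (by linarith) hA h3'
  exact (((h1.sub h2).sub h3).add h4).mono fun y y' => le_of_eq (by ring)

end Dress

/-! ## §2 (3.135) as printed from p10's `Δ⁽²⁾_π = TᵀΔ⁽²⁾T`, and its majorant for any matrix letter -/

section MatrixForm

variable {X n m : Type} [Fintype X] [Fintype n] [Fintype m] [DecidableEq X] [DecidableEq n] [DecidableEq m]

/-- **(3.135) AS PRINTED** from p10's definition: with `T = tOp = 1 − DG′RD*` ((3.119)), `TᵀKT = K − (1−Tᵀ)K − K(1−T) + (1−Tᵀ)K(1−T)`, i.e.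
«Δ⁽²⁾_π = Δ⁽²⁾ − DRG′D\*Δ⁽²⁾ − Δ⁽²⁾DG′RD\* + DRG′D\*Δ⁽²⁾DG′RD\*» (`1 − T` = `DG′RD*`; `1 − Tᵀ` = `DRG′D*` for symmetric `Δ`, p10's `tOp_transpose`).
[cite: Balaban1985BackgroundPropagators, (3.135) p.422, (3.119) p.419] -/
theorem piOp_expand (K : Matrix X X ℝ) (Δ : Matrix n n ℝ) (Q : Matrix m n ℝ) (a : ℝ) (D : Matrix X n ℝ) :
    B9SectDFP.piOp K Δ Q a D =
      K - (1 - (B9SectDFP.tOp Δ Q a D)ᵀ) * K - K * (1 - B9SectDFP.tOp Δ Q a D)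
        + (1 - (B9SectDFP.tOp Δ Q a D)ᵀ) * K * (1 - B9SectDFP.tOp Δ Q a D) := by
  rw [B9SectDFP.piOp]
  generalize B9SectDFP.tOp Δ Q a D = Tm
  noncomm_ring

/-- the same for the operators: `Δ⁽²⁾_π = K − Pᵀ∘K − K∘P + Pᵀ∘(K∘P)` as linear maps, `P = 1 − T`. [cite: Balaban1985BackgroundPropagators, (3.135) p.422] -/
theorem mulVecLin_piOp (K : Matrix X X ℝ) (Δ : Matrix n n ℝ) (Q : Matrix m n ℝ) (a : ℝ) (D : Matrix X n ℝ) :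
    Matrix.mulVecLin (B9SectDFP.piOp K Δ Q a D) =
      Matrix.mulVecLin K - Matrix.mulVecLin (1 - (B9SectDFP.tOp Δ Q a D)ᵀ) ∘ₗ Matrix.mulVecLin K
        - Matrix.mulVecLin K ∘ₗ Matrix.mulVecLin (1 - B9SectDFP.tOp Δ Q a D)
        + Matrix.mulVecLin (1 - (B9SectDFP.tOp Δ Q a D)ᵀ) ∘ₗ (Matrix.mulVecLin K ∘ₗ
            Matrix.mulVecLin (1 - B9SectDFP.tOp Δ Q a D)) := by
  refine LinearMap.ext fun μ => ?_
  simp only [LinearMap.sub_apply, LinearMap.add_apply, LinearMap.comp_apply, Matrix.mulVecLin_apply, piOp_expand,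
    Matrix.add_mulVec, Matrix.sub_mulVec, Matrix.mulVec_sub, Matrix.one_mulVec, ← Matrix.mulVec_mulVec]

variable {g : B6.Geometry}

/-- **the majorant of `Δ⁽²⁾_π = TᵀKT` from those of `K`, `1 − T`, `1 − Tᵀ`** (any block-normed structure `b` on `X → ℝ`): `K` with `θe^{−ρ₀d}`,
`1 − T` («DG′RD\*») with `pe^{−ρ₀d}`, `1 − Tᵀ` («DRG′D\*») with `p′e^{−ρ₀d}` ⟹ `piOp K` has `θ(1 + κp′c + κpc + κ²pp′c²)·e^{−ρd}`, `ρ + 2σ ≤ ρ₀`.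
[cite: Balaban1985BackgroundPropagators, (3.135) p.422, (3.137)–(3.138) p.423] [cite: Balaban1984PropagatorsII, (2.52)–(2.55) p.232] -/
theorem hasMaj_piOp {b : BlockNorm g (X → ℝ)} (K : Matrix X X ℝ) (Δ : Matrix n n ℝ) (Q : Matrix m n ℝ) (a : ℝ)
    (D : Matrix X n ℝ) {θ p p' ρ₀ ρ σ c : ℝ}
    (htri : B6RandomWalk.Triangle254 g) (hd : ∀ y y' : g.Site, 0 ≤ g.dist y y') (hrow : RowSum g σ c) (hc : 0 ≤ c)
    (hθ : 0 ≤ θ) (hp : 0 ≤ p) (hp' : 0 ≤ p') (hρ : 0 ≤ ρ) (hσ : 0 ≤ σ) (hρσ : ρ + 2 * σ ≤ ρ₀)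
    (hK : HasMaj b b (Matrix.mulVecLin K) (fun y y' => θ * Real.exp (-(ρ₀ * g.dist y y'))))
    (hP : HasMaj b b (Matrix.mulVecLin (1 - B9SectDFP.tOp Δ Q a D)) (fun y y' => p * Real.exp (-(ρ₀ * g.dist y y'))))
    (hPt : HasMaj b b (Matrix.mulVecLin (1 - (B9SectDFP.tOp Δ Q a D)ᵀ))
      (fun y y' => p' * Real.exp (-(ρ₀ * g.dist y y')))) :
    HasMaj b b (Matrix.mulVecLin (B9SectDFP.piOp K Δ Q a D))
      (fun y y' => (θ + b.κ * p' * θ * c + b.κ * θ * p * c + b.κ * p' * (b.κ * θ * p * c) * c) *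
        Real.exp (-(ρ * g.dist y y'))) :=
  by rw [mulVecLin_piOp]; exact hasMaj_dress htri hd hrow hc hθ hp hp' hρ hσ hρσ hK hPt hP

end MatrixForm

/-! ## §3 «the operators Δ⁽²⁾, Δ⁽²⁾_π are small in a proper sense» FOR THE CONCRETE `Δ⁽²⁾ = delta2 calC` -/

section Concrete

open NormedSpace Finset Metric Filter
open B7Prop1Explicit B7Prop1Local B7Prop2Explicit B7Prop3Flat B7Prop4Flat B7Eq92Concrete B7Prop3GeneralLinear
  B7Prop4GeneralLevels B7Prop5GeneralOperators B7Prop5GeneralInduction B7Prop5GeneralLevels B7Ineq149Pairing B7Eq136SecondOrder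
  B9Ineq3137From149 B9Eq3134MatrixConcrete

variable {d : ℕ}
variable {𝔸 : Type*} [NormedRing 𝔸] [NormedAlgebra ℂ 𝔸] [CompleteSpace 𝔸] [NormOneClass 𝔸]

variable (L : ℕ) (hL : 2 ≤ L) {G : Subgroup 𝔸ˣ} (hG : AvgClosed d L G) (k : ℕ)
  (U₀ : B7Prop1Explicit.Site d → Fin d → 𝔸ˣ) (hU₀ : ∀ x κ, U₀ x κ ∈ G) {α₀ : ℝ} (hα : 0 < α₀)
  (hα3 : C0 d * α₀ ≤ 1 / 3) (hα4 : 4 * α₀ ≤ c2' d L) (h52 : pdev U₀ < α₀ * (((L : ℝ) ^ k)⁻¹) ^ 2)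
  {b : ℝ} (hb : 0 < b)
  (hsmall : Real.exp (4 * (800 * ((d : ℝ) + 1) ^ 2 * ((d : ℝ) + 4)) * α₀)
    * (1 + 8 * (131072 * ((d : ℝ) + 1) ^ 2) * ((L : ℝ) ^ k * b)) ≤ 2)
  (hc₃ : 4 * ((L : ℝ) ^ k * b) < c3 d L)
  (h145 : 8 * d * thetaGen d L α₀ * (L : ℝ)⁻¹ ^ 4 ≤ 1)
  (h155 : (2 * (L : ℝ) - 1) * (L : ℝ)⁻¹ ^ 2 + 2 * d * thetaGen d L α₀ * (L : ℝ)⁻¹ ^ 3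
    + 1 / 8 * (1 + 2 * d * thetaGen d L α₀ * (L : ℝ)⁻¹ ^ 2 + 2 * d * C3Gen d L * ((L : ℝ) ^ k * b)) * (L : ℝ)⁻¹ ^ 2 ≤ 1)
  (S : Finset (B7Prop1Explicit.Site d × Fin d))
  (lv : Finset ℕ) (T : ℕ → Finset (B7Prop1Explicit.Site d × Fin d)) (w : ℕ → B7Prop1Explicit.Site d × Fin d → ℝ)
  (K : ℕ → B7Prop1Explicit.Site d × Fin d → 𝔸)

variable {ι : Type} [Fintype ι] [DecidableEq ι] (e : ι → 𝔸) (τ : 𝔸 →L[ℝ] ℝ)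
variable {g : B6.Geometry} (blk : S × ι → g.Site)
variable {n m : Type} [Fintype n] [Fintype m] [DecidableEq n] [DecidableEq m]

omit [DecidableEq ι] in
/-- the cut constant of the sharp blocks is `1`. [cite: Balaban1984PropagatorsII, (2.52) p.232] -/
theorem ofBlocks_κ : (BlockNorm.ofBlocks g blk).κ = 1 := rfl

include hL hG hU₀ hα hα3 hα4 h52 hb hsmall hc₃ h145 h155 in
/-- **`Δ⁽²⁾_π` IS SMALL IN A PROPER SENSE** (p. 423) for the CONCRETE `Δ⁽²⁾ = delta2 calC` of FILE 74: under the printed `(H*J)`-budget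
(`w_j(c)‖K_j(c)‖ ≤ c₀Mα₀(Lʲ)^{d−2}`, `2 ≤ d`), `‖e_i‖ ≤ M_e`, the box range `R` of FILE 74 §7 (`hR`), the row sum (2.61) at rate `σ` with constant
`c ≥ 0`, the triangle inequality (2.54), and majorants `pe^{−(ρ+2σ)d}` / `p′e^{−(ρ+2σ)d}` of `DG′RD*` = `1 − tOp` / `DRG′D*` = `1 − tOpᵀ` (HYPOTHESES of
printed shape), p10's `Δ⁽²⁾_π = delta2pi calC Δ Q a D` has the majorant `θ_Δ·e^{(ρ+2σ)R}·(1 + p′c + pc + p′pc²)·e^{−ρd}` between the sharp-block sup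
sizes, `θ_Δ = [2dC₃‖τ‖(Σ_i‖e_i‖)M_e c₀·#lv]·(Mα₀)` — `O(1)·Mα₀`. [cite: Balaban1985BackgroundPropagators, (3.135) p.422, (3.137)–(3.138) p.423]
[cite: Balaban1984PropagatorsII, (2.51)–(2.55) p.232, (2.61) p.234] [cite: Balaban1985Averaging, (141)–(142) p.39, (149) p.40] -/
theorem hasMaj_delta2pi_calC (hd : 2 ≤ d) (hJ : ∀ j ∈ lv, j ≤ k) (hw : ∀ j ∈ lv, ∀ c ∈ T j, 0 ≤ w j c)
    {c₀ M Me : ℝ} (hc₀ : 0 ≤ c₀ * M) (hMe : 0 ≤ Me) (he : ∀ i, ‖e i‖ ≤ Me)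
    (hK : ∀ j ∈ lv, ∀ c ∈ T j, w j c * ‖K j c‖ ≤ c₀ * M * α₀ * ((L : ℝ) ^ j) ^ (d - 2))
    {R : ℝ} {ρ σ cr p p' : ℝ}
    (hR : ∀ j ∈ lv, ∀ c ∈ T j, ∀ y y' : g.Site, BoxMeets L S blk j c y → BoxMeets L S blk j c y' → g.dist y y' ≤ R)
    (htri : B6RandomWalk.Triangle254 g) (hdist : ∀ y y' : g.Site, 0 ≤ g.dist y y') (hrow : RowSum g σ cr) (hcr : 0 ≤ cr)
    (hρ : 0 ≤ ρ) (hσ : 0 ≤ σ) (hp : 0 ≤ p) (hp' : 0 ≤ p')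
    (Δ : Matrix n n ℝ) (Q : Matrix m n ℝ) (a : ℝ) (D : Matrix (S × ι) n ℝ)
    (hP : HasMaj (BlockNorm.ofBlocks g blk) (BlockNorm.ofBlocks g blk) (Matrix.mulVecLin (1 - B9SectDFP.tOp Δ Q a D))
      (fun y y' => p * Real.exp (-((ρ + 2 * σ) * g.dist y y'))))
    (hPt : HasMaj (BlockNorm.ofBlocks g blk) (BlockNorm.ofBlocks g blk) (Matrix.mulVecLin (1 - (B9SectDFP.tOp Δ Q a D)ᵀ))
      (fun y y' => p' * Real.exp (-((ρ + 2 * σ) * g.dist y y')))) :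
    HasMaj (BlockNorm.ofBlocks g blk) (BlockNorm.ofBlocks g blk)
      (Matrix.mulVecLin (B9Delta2Def134.delta2pi (calC L U₀ S lv T w K e τ) Δ Q a D))
      (fun y y' => ((2 * d * C3Gen d L * ‖τ‖ * (∑ i, ‖e i‖) * Me * c₀ * lv.card) * (M * α₀) * Real.exp ((ρ + 2 * σ) * R)) *
        (1 + p' * cr + p * cr + p' * p * cr ^ 2) * Real.exp (-(ρ * g.dist y y'))) := by
  have hδ : 0 ≤ ρ + 2 * σ := by linarith
  -- FILE 74 §7: the concrete `Δ⁽²⁾` at rate `ρ + 2σ`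
  have hΔ2 := hasMaj_delta2_calC_exp L hL hG k U₀ hU₀ hα hα3 hα4 h52 hb hsmall hc₃ h145 h155 S lv T w K e τ blk hd hJ hw hc₀
    hMe he hK hδ hR
  have hE : 0 ≤ ∑ i, ‖e i‖ := Finset.sum_nonneg fun i _ => norm_nonneg _
  have hC := C3Gen_nonneg d L
  have hθ : 0 ≤ (2 * d * C3Gen d L * ‖τ‖ * (∑ i, ‖e i‖) * Me * c₀ * lv.card) * (M * α₀) * Real.exp ((ρ + 2 * σ) * R) := by
    rw [show (2 * d * C3Gen d L * ‖τ‖ * (∑ i, ‖e i‖) * Me * c₀ * lv.card) * (M * α₀) * Real.exp ((ρ + 2 * σ) * R) =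
        2 * d * C3Gen d L * ‖τ‖ * (∑ i, ‖e i‖) * Me * lv.card * (c₀ * M * α₀) * Real.exp ((ρ + 2 * σ) * R) by ring]
    have : 0 ≤ c₀ * M * α₀ := mul_nonneg hc₀ hα.le
    positivity
  have h := hasMaj_piOp (b := BlockNorm.ofBlocks g blk) (B9Delta2Def134.delta2 (calC L U₀ S lv T w K e τ)) Δ Q a D
    htri hdist hrow hcr hθ hp hp' hρ hσ le_rfl hΔ2 hP hPt
  refine (h.congr fun μ => rfl).mono fun y y' => le_of_eq ?_
  rw [ofBlocks_κ]
  ring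

end Concrete

/-! ## §4 (3.138): the random-walk expansion for `G₁` with the `Δ⁽²⁾_π` summand concrete -/

section Series

variable {g : B6.Geometry} {X F₀ : Type} [AddCommGroup F₀] [Module ℝ F₀]

/-- **(3.138) FOR THE RIGHT ENTRIES `G₁F`** — «G₁ = G₀(I − (Δ′_π + Δ⁽²⁾_π)G₀)⁻¹ = Σ_n G₀((Δ′_π + Δ⁽²⁾_π)G₀)ⁿ … convergent for α₀ restricted by a
small, absolute constant»: `B9SectDL2Decay.rightEntry_majorant` with the perturbation `T′ = Δ′_π + Δ⁽²⁾_π`, where `Δ′_π` is a LETTER `T1` with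
majorant `θ₁e^{−δ₁d}` ((3.120)–(3.121), rows by reference) and `Δ⁽²⁾_π` is ANY operator `T2` with majorant `θ₂e^{−δ₁d}` — for the concrete one feed
`hasMaj_delta2pi_calC` (rate `ρ := δ₁`): `G₀` with `Be^{−δ₁d}` (Theorem 3.3), the `F`-entry `G₀F` with `Ae^{−δ₁d}`, an a-priori bound `M₀` for `G₁F`,
the fixed-point form `G₁ = G₀ + G₀T′G₁` of (3.138), and `q = κ²B(θ₁ + θ₂)c² < 1` («α₀ restricted by a small, absolute constant») ⟹ `G₁F` has the
majorant `A(1 − q)⁻¹e^{−ρd}`, `ρ + 2σ ≤ δ₁`. [cite: Balaban1985BackgroundPropagators, (3.138) p.423, (3.130) p.421]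
[cite: Balaban1984PropagatorsII, (2.52)–(2.55) p.232, Lemma 2.1 (2.61) p.234] -/
theorem series3138_rightEntry {b₀ : BlockNorm g F₀} {bX : BlockNorm g (X → ℝ)} {G1 G0 T1 T2 : Module.End ℝ (X → ℝ)}
    {Fop : F₀ →ₗ[ℝ] (X → ℝ)} {B θ₁ θ₂ A M₀ δ₁ ρ σ c : ℝ}
    (htri : B6RandomWalk.Triangle254 g) (hd : ∀ y y' : g.Site, 0 ≤ g.dist y y') (hrow : RowSum g σ c)
    (hB : 0 ≤ B) (hθ₁ : 0 ≤ θ₁) (hθ₂ : 0 ≤ θ₂) (hA : 0 ≤ A) (hM₀ : 0 ≤ M₀) (hρ : 0 ≤ ρ) (hσ : 0 ≤ σ) (hρδ : ρ + 2 * σ ≤ δ₁)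
    (hG0 : HasMaj bX bX G0 (fun y y' => B * Real.exp (-(δ₁ * g.dist y y'))))
    (hT1 : HasMaj bX bX T1 (fun y y' => θ₁ * Real.exp (-(δ₁ * g.dist y y'))))
    (hT2 : HasMaj bX bX T2 (fun y y' => θ₂ * Real.exp (-(δ₁ * g.dist y y'))))
    (hS : HasMaj b₀ bX (G0 ∘ₗ Fop) (fun y y' => A * Real.exp (-(δ₁ * g.dist y y'))))
    (hfix : G1 = G0 + G0 * (T1 + T2) * G1)
    (hap : HasMaj b₀ bX (G1 ∘ₗ Fop) (fun _ _ => M₀))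
    (hq : bX.κ * (bX.κ * B * (θ₁ + θ₂) * c) * c < 1) :
    HasMaj b₀ bX (G1 ∘ₗ Fop)
      (fun y y' => A * (1 - bX.κ * (bX.κ * B * (θ₁ + θ₂) * c) * c)⁻¹ * Real.exp (-(ρ * g.dist y y'))) :=
  B9SectDL2Decay.rightEntry_majorant htri hd hrow hB (add_nonneg hθ₁ hθ₂) hA hM₀ hρ hσ hρδ hG0
    ((hT1.add hT2).mono fun y y' => le_of_eq (by ring)) hS hfix hap hq

end Series

end Literature.MathematicalPhysics.QuantumFieldTheory.Balaban1983to89.B9Delta2PiMajorant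

end
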